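import Summits.BirchSwinnertonDyer.BirchSwinnertonDyer.Theses.TangentCone
import Summits.BirchSwinnertonDyer.BirchSwinnertonDyer.Theorems.TangentConeEdgeCapStubTwoVariableInterpolationOfGS
import Summits.BirchSwinnertonDyer.BirchSwinnertonDyer.Theorems.TangentConeEdgeCapStubPadicLFunctionNeZero
import Literature.NumberTheory.EllipticCurves.CuspFormLFunctionCriticalNonvanishingProofs
import Literature.NumberTheory.EllipticCurves.TwoVariablePadicLFunction
import Literature.NumberTheory.EllipticCurves.EisensteinNewformLevelRaisingDeligneSerreLiftProofs
import Literature.NumberTheory.Automorphic.HilbertPartialHasseWeightShiftingProofs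
import HarnessLib

/-!
# BirchSwinnertonDyer / TangentCone — crux `EdgeCap` (stmt-BirchSwinnertonDyer-17609), line
# `ratio_measure_strassmann` (skeleton v7): the ratio interpolant A1 from the named facts

The registered statement A1 `stub_interpolant` of the line (v5/v6; in v7 no longer a stub) — an
INTEGRAL two-variable series `F ∈ ℚ_p⟦X,Y⟧` with non-zero weight-2 fibre which interpolates, for
every branch member `(k, g, ι, s)` of the progression `2b(p−1) ∣ k − 2`, `b(s−1) = a(k−2)` and every
odd reference index `3 ≤ j`, `(p−1) ∣ (j−1)`, `2j+2 ≤ k`, the edge RATIOS in norm form,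
`F(x_k,y_j) ≠ 0` and `‖ι(Λ(g,s)/Λ(g,j))‖·‖F(x_k,y_j)‖ = ‖F(x_k,y_s)‖` — is DERIVED here from two named
facts of the tree:

* `Literature.NumberTheory.EllipticCurves.greenbergStevens_kitagawa_twoVariable_interpolation`
  (Greenberg–Stevens 1993 Thm 5.15 / Kitagawa 1994, as recalled in Delbourgo 2008 Thm 4.11, Def. 4.12;
  file `Literature/NumberTheory/EllipticCurves/TwoVariablePadicLFunction.lean`, p152672; NOT
  discharged), through the landed reduction `Theorems.stub_twoVariableInterpolation_of_fact` (p152673),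
* `Literature.NumberTheory.EllipticCurves.ModularForms.exists_isNewformOf` (modularity; NOT
  discharged), through `Theorems.stub_padicLFunctionNeZero_of_modularity` (p153322, which consumes the
  DISCHARGED Rohrlich fact `padicLFunction_ne_zero_holds`),

plus tree theorems: T4 `IsNewform0.completedLValue_ne_zero_of_two_mul_add_two_lt` (non-vanishing of
`Λ(g,j)` for `2j+2 < k`, here from `k ≡ 2 (mod 4)` on the progression and `j` odd) and the `p`-adic
unit lemmas below (the Euler factor `(1 − p^{n−1}/α)(1 − p^{k−1−n}/α)` is a unit for `0 < n < k − n`;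
at `n = s = 1` this is exactly where the crux hypothesis `a_p ≢ 1 (mod p)` is consumed, through
`α ≡ a_p(E)`). Proof: divide two instances (`n = s`, `n = j`) of the value formula of the GS fact at
the same `(k, g, ι)` (same `p`-adic period `Ω`, same complex period `ω`), and use
`iˢΛ(g,s)/ω = ±(Λ(g,s)/Λ(g,j))·(iʲΛ(g,j)/ω)` in `K_g`; the weight-2 fibre is non-zero because it is
`c·L_p(f,α,T)` with `c ≠ 0` and `L_p(f,α,T) ≠ 0`.

`stub_interpolant_of_facts` is the registered colon form
`GS-fact → exists_isNewformOf → (A1 verbatim)`; it SUPPORTS stmt-BirchSwinnertonDyer-17609 (does not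
close it). No definition, no new named fact; nothing shaped like the crux or like the stubs M, G, L, A2
is asserted unconditionally.
-/

-- D-0017: single-problem summit, so `Summit.BirchSwinnertonDyer.BirchSwinnertonDyer.…` repeats a
-- namespace BY DESIGN.
set_option linter.dupNamespace false

noncomputable section

namespace Summit.BirchSwinnertonDyer.BirchSwinnertonDyer.Theorems

namespace TangentConeEdgeCap

section UnitLemmas

open Complex

variable {p : ℕ} [Fact p.Prime]

/-- In an ultrametric normed ring with `‖1‖ = 1`, `‖1 − x‖ = 1` whenever `‖x‖ < 1`. -/
theorem norm_one_sub_eq_one_of_norm_lt_one {K : Type*} [NormedRing K] [NormOneClass K] [IsUltrametricDist K]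
    {x : K} (hx : ‖x‖ < 1) : ‖1 - x‖ = 1 := by
  have h : ‖(1 : K)‖ ≠ ‖-x‖ := by rw [norm_neg, norm_one]; exact hx.ne'
  rw [sub_eq_add_neg, IsUltrametricDist.norm_add_eq_max_of_norm_ne_norm h, norm_one, norm_neg,
    max_eq_left hx.le]

/-- The Euler-factor term `1 − p^m/α` is a `p`-adic unit for `m ≠ 0` and a unit `α`. -/
theorem norm_one_sub_pow_div_eq_one {α : PadicAlgCl p} (hα : ‖α‖ = 1) {m : ℕ} (hm : m ≠ 0) :
    ‖1 - (p : PadicAlgCl p) ^ m / α‖ = 1 := by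
  apply norm_one_sub_eq_one_of_norm_lt_one
  rw [norm_div, hα, div_one, norm_pow]
  exact pow_lt_one₀ (norm_nonneg _) (Literature.NumberTheory.Automorphic.PadicAlgCl.norm_natCast_p_lt_one p) hm

/-- The Euler-factor term at `n = 1`: `‖1 − 1/α‖ = 1` when `α ≡ a_p` modulo the maximal ideal and `p ∤ a_p − 1`. -/
theorem norm_one_sub_pow_zero_div_eq_one {α : PadicAlgCl p} (hα : ‖α‖ = 1) {ap : ℤ}
    (hcong : ‖α - (ap : PadicAlgCl p)‖ < 1) (hna : ¬ (p : ℤ) ∣ ap - 1) :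
    ‖1 - (p : PadicAlgCl p) ^ 0 / α‖ = 1 := by
  have hα0 : α ≠ 0 := by rintro rfl; simp at hα
  have h1 : (1 : PadicAlgCl p) - (p : PadicAlgCl p) ^ 0 / α = (α - 1) / α := by
    rw [pow_zero]; field_simp
  rw [h1, norm_div, hα, div_one]
  have hint : ‖(((ap - 1 : ℤ)) : PadicAlgCl p)‖ = 1 :=
    Literature.NumberTheory.EllipticCurves.ModularForms.DeligneSerreLift.norm_intCast_eq_one_of_not_dvd hna
  have hsplit : α - 1 = (α - (ap : PadicAlgCl p)) + ((ap - 1 : ℤ) : PadicAlgCl p) := by push_cast; ring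
  have hne : ‖α - (ap : PadicAlgCl p)‖ ≠ ‖((ap - 1 : ℤ) : PadicAlgCl p)‖ := by rw [hint]; exact hcong.ne
  rw [hsplit, IsUltrametricDist.norm_add_eq_max_of_norm_ne_norm hne, hint, max_eq_right hcong.le]

/-- The Euler factor `(1 − p^{n−1}/α)(1 − p^{K−n}/α)` of the two-variable interpolation is a `p`-adic unit for
`0 < n < K`, a unit `α ≡ a_p` and `p ∤ a_p − 1` (the last two only matter at `n = 1`). -/
theorem norm_eulerFactor_eq_one {α : PadicAlgCl p} (hα : ‖α‖ = 1) {ap : ℤ}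
    (hcong : ‖α - (ap : PadicAlgCl p)‖ < 1) (hna : ¬ (p : ℤ) ∣ ap - 1) {n K : ℕ} (hn : 0 < n) (hK : n < K) :
    ‖(1 - (p : PadicAlgCl p) ^ (n - 1) / α) * (1 - (p : PadicAlgCl p) ^ (K - n) / α)‖ = 1 := by
  rw [norm_mul, norm_one_sub_pow_div_eq_one hα (by omega : K - n ≠ 0), mul_one]
  by_cases h1 : n = 1
  · subst h1
    exact norm_one_sub_pow_zero_div_eq_one hα hcong hna
  · exact norm_one_sub_pow_div_eq_one hα (by omega)

/-- `iⁿ = ±i` for odd `n`. -/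
theorem I_pow_odd {n : ℕ} (hn : Odd n) : ∃ σ : ℂ, (σ = 1 ∨ σ = -1) ∧ I ^ n = σ * I := by
  obtain ⟨m, rfl⟩ := hn
  refine ⟨(-1) ^ m, ?_, by rw [pow_add, pow_mul, I_sq, pow_one]⟩
  rcases neg_one_pow_eq_or ℂ m with h | h <;> simp [h]

end UnitLemmas

end TangentConeEdgeCap

open Complex Literature.NumberTheory.EllipticCurves Literature.NumberTheory.EllipticCurves.ModularForms
  TangentConeEdgeCap in
/-- **A1 (the ratio interpolant) from the Greenberg–Stevens/Kitagawa fact and modularity.** Assume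
`greenbergStevens_kitagawa_twoVariable_interpolation` (GS93 Thm 5.15 / Kitagawa94 / Delbourgo 2008
Thm 4.11) and `exists_isNewformOf` (modularity). Then for admissible `(W, p)` with (Br) and a coprime
slope pair `a/b < 1/2` there is an integral `F ∈ ℚ_p⟦X,Y⟧` with non-zero weight-2 fibre such that for
every branch member `(k, g, ι, s)` of the progression and every odd reference index `3 ≤ j`,
`(p−1) ∣ (j−1)`, `2j+2 ≤ k`: `F(x_k,y_j) ≠ 0` and `‖ι(Λ(g,s)/Λ(g,j))‖·‖F(x_k,y_j)‖ = ‖F(x_k,y_s)‖`,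
`x_k = (1+p)^{k−2} − 1`, `y_n = (1+p)^{n−1} − 1`. [cite: GreenbergStevens1993, Thm 5.15]
[cite: Delbourgo2008, Thm 4.11] -/
theorem interpolant_of_facts
    (hGS : Literature.NumberTheory.EllipticCurves.greenbergStevens_kitagawa_twoVariable_interpolation)
    (hmod : Literature.NumberTheory.EllipticCurves.ModularForms.exists_isNewformOf) :
    ∀ (W : WeierstrassCurve ℚ) [W.IsElliptic] [W.IsGloballyMinimal] (_ : NeZero (W.conductorNorm ℤ)) (p : ℕ)
      [Fact p.Prime], 5 ≤ p → W.HasGoodReductionAtPrime p → ¬ (p : ℤ) ∣ W.frobeniusTrace p → ¬ (p : ℤ) ∣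
      (W.frobeniusTrace p) ^ 2 - 1 → W.HasSurjectiveModNGaloisRep p → (∀ (M : ℕ) (_ : NeZero M) (g :
      CuspForm (CongruenceSubgroup.Gamma0 M) 2) (ι :
      Literature.NumberTheory.EllipticCurves.ModularForms.coeffField g →+* PadicAlgCl p), M ∣
      W.conductorNorm ℤ * p → Literature.NumberTheory.EllipticCurves.ModularForms.IsNewform0 g → ‖ι
      ⟨(UpperHalfPlane.qExpansion 1 ⇑g).coeff p,
      Literature.NumberTheory.EllipticCurves.ModularForms.coeff_mem_coeffField g p⟩‖ = 1 → (∀ ℓ : ℕ, ℓ.Prime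
      → ¬ ℓ ∣ W.conductorNorm ℤ * p → ‖ι ⟨(UpperHalfPlane.qExpansion 1 ⇑g).coeff ℓ,
      Literature.NumberTheory.EllipticCurves.ModularForms.coeff_mem_coeffField g ℓ⟩ - ((W.frobeniusTrace ℓ :
      ℤ) : PadicAlgCl p)‖ < 1) → M = W.conductorNorm ℤ ∧ ∀ n : ℕ, (UpperHalfPlane.qExpansion 1 ⇑g).coeff n =
      ((W.LFunction n : ℤ) : ℂ)) → ∀ (a b : ℕ), 0 < b → 2 * a < b → a.Coprime b → ∃ F : MvPowerSeries (Fin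
      2) ℚ_[p], Literature.NumberTheory.EllipticCurves.IsPadicInt F ∧ (∃ i : ℕ, MvPowerSeries.coeff (Finsupp.single 1 i) F ≠ 0) ∧ (∀ (k : ℤ) (g : CuspForm
      (CongruenceSubgroup.Gamma0 (W.conductorNorm ℤ)) k) (ι :
      Literature.NumberTheory.EllipticCurves.ModularForms.coeffField g →+* PadicAlgCl p) (s : ℕ), (2 * b *
      (p - 1) : ℤ) ∣ (k - 2) → (b : ℤ) * ((s : ℤ) - 1) = a * (k - 2) →
      Literature.NumberTheory.EllipticCurves.ModularForms.IsNewform0 g → ‖ι ⟨(UpperHalfPlane.qExpansion 1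
      ⇑g).coeff p, Literature.NumberTheory.EllipticCurves.ModularForms.coeff_mem_coeffField g p⟩‖ = 1 → (∀ ℓ
      : ℕ, ℓ.Prime → ¬ ℓ ∣ W.conductorNorm ℤ * p → ‖ι ⟨(UpperHalfPlane.qExpansion 1 ⇑g).coeff ℓ,
      Literature.NumberTheory.EllipticCurves.ModularForms.coeff_mem_coeffField g ℓ⟩ - ((W.frobeniusTrace ℓ :
      ℤ) : PadicAlgCl p)‖ < 1) → ∀ j : ℕ, Odd j → 3 ≤ j → (p - 1) ∣ (j - 1) → 2 * (j : ℤ) + 2 ≤ k →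
      Literature.NumberTheory.EllipticCurves.padicEval₂ F ((1 + (p : ℚ_[p])) ^ (k - 2) - 1) ((1 + (p :
      ℚ_[p])) ^ (j - 1) - 1) ≠ 0 ∧ ∀ hR : (∫ t in Set.Ioi (0 : ℝ), ((t : ℂ) ^ (s - 1)) * g
      (UpperHalfPlane.ofComplex ((t : ℂ) * Complex.I))) / (∫ t in Set.Ioi (0 : ℝ), ((t : ℂ) ^ (j - 1)) * g
      (UpperHalfPlane.ofComplex ((t : ℂ) * Complex.I))) ∈
      Literature.NumberTheory.EllipticCurves.ModularForms.coeffField g, ‖ι ⟨_, hR⟩‖ *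
      ‖Literature.NumberTheory.EllipticCurves.padicEval₂ F ((1 + (p : ℚ_[p])) ^ (k - 2) - 1) ((1 + (p :
      ℚ_[p])) ^ (j - 1) - 1)‖ = ‖Literature.NumberTheory.EllipticCurves.padicEval₂ F ((1 + (p : ℚ_[p])) ^ (k
      - 2) - 1) ((1 + (p : ℚ_[p])) ^ (s - 1) - 1)‖) := by
  have hG := stub_twoVariableInterpolation_of_fact hGS
  have hL := stub_padicLFunctionNeZero_of_modularity hmod
  intro W _ _ hN p _ h5 hgood hord hna hsurj hBr a b hb hab hcop
  obtain ⟨F, hFi, hwt2, hval⟩ := hG W hN p h5 hgood hord hsurj hBr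
  refine ⟨F, hFi, ?_, ?_⟩
  · -- (wt-2): the weight-2 fibre series is `c · L_p(f, α, T) ≠ 0`
    obtain ⟨f, hf, hLne⟩ := hL W hN p h5 hgood hord
    obtain ⟨c, hc, hcoeff⟩ := hwt2 f hf
    by_contra hall
    push Not at hall
    apply hLne
    ext i
    have h := hcoeff i
    rw [hall i] at h
    rw [map_zero]
    rcases mul_eq_zero.mp h.symm with h0 | h0
    · exact absurd h0 hc
    · exact h0
  · intro k g ι s hdiv hs hnew hordg hcong j hjodd hj3 hjp hjk
    -- numerology of the progression
    have hp1 : 1 ≤ p := by omega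
    have hp2 : p ≠ 2 := by omega
    obtain ⟨r, hr⟩ : Odd p := (Fact.out : p.Prime).eq_two_or_odd'.resolve_left hp2
    obtain ⟨q, hq⟩ := hdiv
    have hb0 : (0 : ℤ) < b := by exact_mod_cast hb
    have hpm : (0 : ℤ) < (p : ℤ) - 1 := by omega
    have hk8 : (8 : ℤ) ≤ k := by omega
    have hc0 : (0 : ℤ) < 2 * (b : ℤ) * ((p : ℤ) - 1) := mul_pos (mul_pos two_pos hb0) hpm
    have hq0 : 0 < q := by
      rcases lt_trichotomy q 0 with h | h | h
      · have : 2 * (b : ℤ) * ((p : ℤ) - 1) * q < 0 := mul_neg_of_pos_of_neg hc0 h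
        omega
      · subst h; simp at hq; omega
      · exact h
    have hs1 : (s : ℤ) - 1 = 2 * a * ((p : ℤ) - 1) * q := by
      have h1 : (b : ℤ) * ((s : ℤ) - 1) = (b : ℤ) * (2 * a * ((p : ℤ) - 1) * q) := by rw [hs, hq]; ring
      exact mul_left_cancel₀ hb0.ne' h1
    have hapq : (0 : ℤ) ≤ 2 * (a : ℤ) * ((p : ℤ) - 1) * q :=
      mul_nonneg (mul_nonneg (by positivity) hpm.le) hq0.le
    have hs0 : 0 < s := by omega
    have h2s : 2 * (s : ℤ) < k := by
      have hab' : (2 * (a : ℤ)) < b := by exact_mod_cast hab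
      have hpq : (0 : ℤ) < ((p : ℤ) - 1) * q := mul_pos hpm hq0
      nlinarith [mul_lt_mul_of_pos_right hab' hpq, hs1, hq]
    have hsodd : Odd s :=
      (Int.odd_coe_nat s).mp ⟨(a : ℤ) * ((p : ℤ) - 1) * q, by linarith [hs1]⟩
    have hsp : (p - 1) ∣ (s - 1) := by
      obtain ⟨t, rfl⟩ := Int.eq_ofNat_of_zero_le hq0.le
      have h : ((p - 1 : ℕ) : ℤ) ∣ ((s - 1 : ℕ) : ℤ) := by
        refine ⟨2 * a * t, ?_⟩
        rw [Nat.cast_sub (by omega), Nat.cast_sub hp1]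
        push_cast
        linear_combination hs1
      exact Int.natCast_dvd_natCast.mp h
    have hk2 : 2 < k := by omega
    have hpk : ((p : ℤ) - 1) ∣ (k - 2) := ⟨2 * b * q, by rw [hq]; ring⟩
    -- `k ≡ 2 (mod 4)` and `j` odd give T4's strict inequality `2j + 2 < k`
    have hjlt : 2 * (j : ℤ) + 2 < k := by
      obtain ⟨m, hm⟩ := hjodd
      obtain ⟨M4, hM4⟩ : ∃ M4 : ℤ, k - 2 = 4 * M4 := ⟨(b : ℤ) * r * q, by rw [hq, hr]; push_cast; ring⟩
      omega
    have hj2 : 2 * (j : ℤ) < k := by omega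
    -- the member data from G at `(k, g, ι)`, at `n = j` and at `n = s`
    obtain ⟨Ω, α, ω, hΩ, hω, hαn, -, hαcong, hvals⟩ := hval k g ι hk2 hpk hnew hordg hcong
    obtain ⟨hmj, hFj⟩ := hvals j (by omega) hj2 hjodd hjp
    obtain ⟨hms, hFs⟩ := hvals s hs0 h2s hsodd hsp
    -- unit Euler factors
    have hna1 : ¬ (p : ℤ) ∣ W.frobeniusTrace p - 1 := by
      intro h
      apply hna
      have : (W.frobeniusTrace p) ^ 2 - 1 = (W.frobeniusTrace p - 1) * (W.frobeniusTrace p + 1) := by ring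
      rw [this]
      exact h.mul_right _
    have hK : ∀ n : ℕ, 2 * (n : ℤ) < k → n < (k - 1).toNat := by
      intro n hn
      have : ((k - 1).toNat : ℤ) = k - 1 := Int.toNat_of_nonneg (by omega)
      omega
    rw [norm_eulerFactor_eq_one hαn hαcong hna1 (by omega : 0 < j) (hK j hj2), mul_one] at hFj
    rw [norm_eulerFactor_eq_one hαn hαcong hna1 hs0 (hK s h2s), mul_one] at hFs
    -- abbreviations
    set xk : ℚ_[p] := (1 + (p : ℚ_[p])) ^ (k - 2) - 1 with hxk
    set Aj : ℂ := I ^ j * completedLValue g j / ω with hAj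
    set As : ℂ := I ^ s * completedLValue g s / ω with hAs
    -- non-vanishing of the reference value (T4) and of its `ι`-image
    have hΛj : completedLValue g j ≠ 0 :=
      hnew.completedLValue_ne_zero_of_two_mul_add_two_lt (by omega) hjlt
    have hAj0 : Aj ≠ 0 := by
      rw [hAj]
      exact div_ne_zero (mul_ne_zero (pow_ne_zero _ I_ne_zero) hΛj) hω
    have hιAj0 : ι ⟨Aj, hmj⟩ ≠ 0 := by
      rw [map_ne_zero ι]
      exact fun h => hAj0 (congrArg Subtype.val h)
    have hΩ' : 0 < ‖Ω‖ := norm_pos_iff.mpr hΩ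
    refine ⟨?_, fun hR => ?_⟩
    · -- `F(x_k, y_j) ≠ 0`
      intro h0
      rw [h0, norm_zero] at hFj
      have : 0 < ‖Ω‖ * ‖ι ⟨Aj, hmj⟩‖ := mul_pos hΩ' (norm_pos_iff.mpr hιAj0)
      linarith
    · -- the ratio identity: `Λ(g,s)/Λ(g,j) · Aj = ± As` in `K_g`
      obtain ⟨σs, hσs, hIs⟩ := I_pow_odd hsodd
      obtain ⟨σj, hσj, hIj⟩ := I_pow_odd hjodd
      have hσmem : σj * σs ∈ coeffField g :=
        mul_mem (by rcases hσj with rfl | rfl <;> simp) (by rcases hσs with rfl | rfl <;> simp)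
      have hσnorm : ‖ι ⟨σj * σs, hσmem⟩‖ = 1 := by
        have h1 : (⟨σj * σs, hσmem⟩ : coeffField g) = 1 ∨ (⟨σj * σs, hσmem⟩ : coeffField g) = -1 := by
          rcases hσj with rfl | rfl <;> rcases hσs with rfl | rfl
          · left; exact Subtype.ext (by simp)
          · right; exact Subtype.ext (by simp)
          · right; exact Subtype.ext (by simp)
          · left; exact Subtype.ext (by simp)
        rcases h1 with h | h <;> simp [h]
      have hkey : (⟨completedLValue g s / completedLValue g j, hR⟩ : coeffField g) * ⟨Aj, hmj⟩ =
          ⟨σj * σs, hσmem⟩ * ⟨As, hms⟩ := by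
        apply Subtype.ext
        change completedLValue g s / completedLValue g j * Aj = σj * σs * As
        rw [hAj, hAs, hIs, hIj]
        rcases hσj with rfl | rfl <;> rcases hσs with rfl | rfl <;> field_simp
      have hnorm : ‖ι ⟨completedLValue g s / completedLValue g j, hR⟩‖ * ‖ι ⟨Aj, hmj⟩‖ = ‖ι ⟨As, hms⟩‖ := by
        have := congrArg (fun x => ‖ι x‖) hkey
        simpa only [map_mul, norm_mul, hσnorm, one_mul] using this
      change ‖ι ⟨completedLValue g s / completedLValue g j, hR⟩‖ *
          ‖padicEval₂ F xk ((1 + (p : ℚ_[p])) ^ (j - 1) - 1)‖ = ‖padicEval₂ F xk ((1 + (p : ℚ_[p])) ^ (s - 1) - 1)‖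
      rw [hFj, hFs]
      calc ‖ι ⟨completedLValue g s / completedLValue g j, hR⟩‖ * (‖Ω‖ * ‖ι ⟨Aj, hmj⟩‖)
          = ‖Ω‖ * (‖ι ⟨completedLValue g s / completedLValue g j, hR⟩‖ * ‖ι ⟨Aj, hmj⟩‖) := by ring
        _ = ‖Ω‖ * ‖ι ⟨As, hms⟩‖ := by rw [hnorm]


/-- **Registered colon form of `interpolant_of_facts`** (sub-goal stub `stub_interpolant_of_facts` of
stmt-BirchSwinnertonDyer-17609): the GS/Kitagawa fact and modularity imply statement A1 of line
`ratio_measure_strassmann`. -/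
theorem stub_interpolant_of_facts :
    Literature.NumberTheory.EllipticCurves.greenbergStevens_kitagawa_twoVariable_interpolation →
    Literature.NumberTheory.EllipticCurves.ModularForms.exists_isNewformOf →
    (∀ (W : WeierstrassCurve ℚ) [W.IsElliptic] [W.IsGloballyMinimal] (_ : NeZero (W.conductorNorm ℤ)) (p : ℕ)
      [Fact p.Prime], 5 ≤ p → W.HasGoodReductionAtPrime p → ¬ (p : ℤ) ∣ W.frobeniusTrace p → ¬ (p : ℤ) ∣
      (W.frobeniusTrace p) ^ 2 - 1 → W.HasSurjectiveModNGaloisRep p → (∀ (M : ℕ) (_ : NeZero M) (g :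
      CuspForm (CongruenceSubgroup.Gamma0 M) 2) (ι :
      Literature.NumberTheory.EllipticCurves.ModularForms.coeffField g →+* PadicAlgCl p), M ∣
      W.conductorNorm ℤ * p → Literature.NumberTheory.EllipticCurves.ModularForms.IsNewform0 g → ‖ι
      ⟨(UpperHalfPlane.qExpansion 1 ⇑g).coeff p,
      Literature.NumberTheory.EllipticCurves.ModularForms.coeff_mem_coeffField g p⟩‖ = 1 → (∀ ℓ : ℕ, ℓ.Prime
      → ¬ ℓ ∣ W.conductorNorm ℤ * p → ‖ι ⟨(UpperHalfPlane.qExpansion 1 ⇑g).coeff ℓ,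
      Literature.NumberTheory.EllipticCurves.ModularForms.coeff_mem_coeffField g ℓ⟩ - ((W.frobeniusTrace ℓ :
      ℤ) : PadicAlgCl p)‖ < 1) → M = W.conductorNorm ℤ ∧ ∀ n : ℕ, (UpperHalfPlane.qExpansion 1 ⇑g).coeff n =
      ((W.LFunction n : ℤ) : ℂ)) → ∀ (a b : ℕ), 0 < b → 2 * a < b → a.Coprime b → ∃ F : MvPowerSeries (Fin
      2) ℚ_[p], Literature.NumberTheory.EllipticCurves.IsPadicInt F ∧ (∃ i : ℕ, MvPowerSeries.coeff (Finsupp.single 1 i) F ≠ 0) ∧ (∀ (k : ℤ) (g : CuspForm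
      (CongruenceSubgroup.Gamma0 (W.conductorNorm ℤ)) k) (ι :
      Literature.NumberTheory.EllipticCurves.ModularForms.coeffField g →+* PadicAlgCl p) (s : ℕ), (2 * b *
      (p - 1) : ℤ) ∣ (k - 2) → (b : ℤ) * ((s : ℤ) - 1) = a * (k - 2) →
      Literature.NumberTheory.EllipticCurves.ModularForms.IsNewform0 g → ‖ι ⟨(UpperHalfPlane.qExpansion 1
      ⇑g).coeff p, Literature.NumberTheory.EllipticCurves.ModularForms.coeff_mem_coeffField g p⟩‖ = 1 → (∀ ℓ
      : ℕ, ℓ.Prime → ¬ ℓ ∣ W.conductorNorm ℤ * p → ‖ι ⟨(UpperHalfPlane.qExpansion 1 ⇑g).coeff ℓ,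
      Literature.NumberTheory.EllipticCurves.ModularForms.coeff_mem_coeffField g ℓ⟩ - ((W.frobeniusTrace ℓ :
      ℤ) : PadicAlgCl p)‖ < 1) → ∀ j : ℕ, Odd j → 3 ≤ j → (p - 1) ∣ (j - 1) → 2 * (j : ℤ) + 2 ≤ k →
      Literature.NumberTheory.EllipticCurves.padicEval₂ F ((1 + (p : ℚ_[p])) ^ (k - 2) - 1) ((1 + (p :
      ℚ_[p])) ^ (j - 1) - 1) ≠ 0 ∧ ∀ hR : (∫ t in Set.Ioi (0 : ℝ), ((t : ℂ) ^ (s - 1)) * g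
      (UpperHalfPlane.ofComplex ((t : ℂ) * Complex.I))) / (∫ t in Set.Ioi (0 : ℝ), ((t : ℂ) ^ (j - 1)) * g
      (UpperHalfPlane.ofComplex ((t : ℂ) * Complex.I))) ∈
      Literature.NumberTheory.EllipticCurves.ModularForms.coeffField g, ‖ι ⟨_, hR⟩‖ *
      ‖Literature.NumberTheory.EllipticCurves.padicEval₂ F ((1 + (p : ℚ_[p])) ^ (k - 2) - 1) ((1 + (p :
      ℚ_[p])) ^ (j - 1) - 1)‖ = ‖Literature.NumberTheory.EllipticCurves.padicEval₂ F ((1 + (p : ℚ_[p])) ^ (k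
      - 2) - 1) ((1 + (p : ℚ_[p])) ^ (s - 1) - 1)‖)) :=
  fun hGS hmod => interpolant_of_facts hGS hmod

end Summit.BirchSwinnertonDyer.BirchSwinnertonDyer.Theorems

end
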